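import Mathlib
import Literature.MathematicalPhysics.QuantumFieldTheory.Balaban1983to89.B13

/-!
# `Balaban1983to89.B13Bound238Assembly` — T. Bałaban, *Renormalization group approach to lattice gauge field theories.
II. Cluster expansions*, Commun. Math. Phys. **116** (1988) 1–22 [Balaban1988RG2Cluster]: the closing paragraph of the
proof of Lemma 3, p. 20 — the sum over Z′₀ ⊂ Z taking (2.37) to (2.38) — PROVED as bookkeeping over abstract
resummation data, with the by-reference inputs of the paragraph as explicit hypotheses in the tree's vocabulary

statement-level skeleton of published theorems with citation tags; proofs where landed; nothing here is a claim about
the Yang–Mills mass gap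

PDF held: `paper:balaban1988-cmp116-rg-ii-cluster` (journal page = PDF page + 0); p. 20 re-read this session from the
text layer `p0020.txt` of that key (the displays of pp. 18–20 are quoted verbatim in `…Balaban1983to89.B13` Parts C/E/F
and `…Balaban1983to89.B13Step237`).

CITATION HEADER / WHAT IS REPRODUCED (unit `lit-balaban-r10` gen 4, B13 fold owner; SKELETON rows `B13.Eq2.37` →
`B13.Eq2.38` / `B13.Lem3` of `HOME/lit-balaban-r10/ROWS-B13.md`; HOME = `run/shared/lean/pub/lit-balaban/`).  P. 20
[PDF 20], after (2.37), verbatim: *"The last sum to estimate is the sum over Z′₀, or over Z∖Z′₀. Using the inequality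
(2.32), properly adapted to the new situation, we bound the exponential factors in the square bracket above, and half
of the first exponential factor, by exp(−(1 − 7δ)½Lκd_{k+1}(Z)). Of course, we assume that ½(κ₁ − 1) ≧ 2Lκ. The sum
over Z∖Z′₀ is bounded, using the remaining factor and an inequality similar to (2.34), by exp(exp(−½(κ₁ − 1))(LM)⁻⁴|Z|).
This exponential is of the same type as the last exponential in (2.37), which can be written as
exp O(1)(LM)⁴α₅(LM)⁻⁴|Z|. … Then O(1)(LM)⁴α₅ + exp(−½(κ₁ − 1)) is bounded by an absolute constant. We use the factor
exp(−δ½Lκd_{k+1}(Z)), and the inequality (2.30), to bound the exponentials by 1. We leave one factor 2(L+2)⁴O(1)ε₂,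
and the remaining factors are estimated by 1. We define the constant C₃ = 2(L+2)⁴O(1)2E₀C₁α₄⁻¹α₆⁻¹M^q exp C₂κ₁. Thus we
have finished the estimate of the resummed terms (2.14). The sum defines the activity H(Z), and we have proved the
following lemma. Lemma 3. … |H(Z)| ≦ C₃ε₁ exp(−(1 − 8δ)½Lκd_{k+1}(Z)). (2.38)"*  Every other located step of the
proof of Lemma 3 already has a decl ((2.27)–(2.29) `B13FamilySum`, (2.28)/(2.33)/(2.34) `B13.prod_bound_228` /
`case_empty_233` / `sum_powerset_le_exp_234`, (2.32) `B13Ineq232*`, (2.36) `B13Geometry236*` / `B13.Ineq236With`,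
(2.35) ⇒ (2.37) `B13Step237`); this paragraph had none.

THE DATA (abstract, for ONE localization domain Z ∈ 𝐃_{k+1}; the transfer factor ℓ is general, print ℓ = ½L — cell
reading `B13.Consts.R22gen`): `n` = (LM)⁻⁴|Z| = the number of LM-cubes of Z with an index set `s` of them
(`s.card = n`); `dZ` = d_{k+1}(Z) ≥ 0; a finite type `J` of the admissible Z′₀ ⊂ Z of (2.37) (unions of
𝐃_{k+1}-components), each with the set `w j ⊆ s` of the cubes of Z∖Z′₀ — Z′₀ is determined by it: `w` injective —
and with a non-empty finite family `I j` of components Z′_i of lengths `dI j i` = d_{k+1}(Z′_i) ≥ 0; complex terms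
`T j` = Σ_{𝐃,P,Z₀}(2.14) at fixed Z′₀, so that H(Z) = Σ_j T j.
THE HYPOTHESES (each a printed input of the paragraph, by name): (2.37) `‖T j‖ ≤ e^{−(κ₁−1)|w j|}·Π_i F e^{−r₇·dI j i}
·e^{a₅ n}` (F = 2(L+2)⁴O(1)ε₂ = `B13Step237.bracketF`, r₇ = (1 − 7δ)ℓκ, a₅ = O(1)(LM)⁴α₅ per LM-cube); *"(2.32)
properly adapted"* at scale k + 1 `dZ ≤ Σ_i dI j i + c₃₂·|w j|` with a generic constant c₃₂ (print 4 — refuted for the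
tree's d_k, `B13Ineq232Star`; 17 for `treeLen` at d = 4, `B13Ineq232TreeLength`); R20 as `c₃₂·r₇ ≤ ½(κ₁ − 1)` (print:
*"½(κ₁ − 1) ≧ 2Lκ"* = the case c₃₂ = 4, ℓ = ½L); F ≤ 1 (R18: *"(L+2)⁴O(1)ε₂ ≦ ½"*); the absolute constant
`a₅ + e^{−½(κ₁−1)} ≤ A` (R21, `B13.Consts.perSite_absolute_of_R21`); the volume law in its REPAIRED additive form
`n ≤ c₁(1 + dZ)` (cell GAPS G-B13-07 / HOME GAPS G-B13-P18-01: the printed multiplicative (2.30) fails at d_{k+1}(Z) = 0)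
and `A·c₁ ≤ δℓκ` — so the printed *"bound the exponentials by 1"* becomes "by e^{Ac₁}", the same located slip as
after (2.40) (G-B13-P21-01), absorbed into the O(1) of C₃: `F·e^{Ac₁} ≤ C₃ε₁`.
WHAT IS PROVED: `sum_exp_card_le` (the *"inequality similar to (2.34)"* for an injective family of subsets);
`term_le_237` (one Z′₀: (2.32)-adapted + R20 turn the bracket and half of the first exponential into
F·e^{−r₇ dZ}·e^{−½(κ₁−1)|Z∖Z′₀|}); `norm_sum_le_238` (the paragraph: ‖Σ_j T j‖ ≤ F·e^{Ac₁}·e^{−(r₇ − δℓκ)dZ});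
`bound238With_of_237` (for step data `B13.StepData` whose activity H(Z) is such a sum for every Z ∈ 𝐃_{k+1}:
`B13.Bound238With S c ℓ`, i.e. (2.38) with the general transfer factor; `bound238_of_237` at ℓ = ½L = the printed
(2.38) `B13.Bound238`).  Nothing geometric or analytic is asserted: which Z′₀ occur, (2.37), (2.32), the volume law
are INPUTS; no named fact is introduced (D-0026).
-/

namespace Literature.MathematicalPhysics.QuantumFieldTheory.Balaban1983to89.B13Bound238Assembly

open Finset
open Literature.MathematicalPhysics.QuantumFieldTheory.Balaban1983to89

/-! ## §1. The sum over Z∖Z′₀: *"an inequality similar to (2.34)"* -/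

/-- P. 20: *"The sum over Z∖Z′₀ is bounded, using the remaining factor and an inequality similar to (2.34), by
exp(exp(−½(κ₁ − 1))(LM)⁻⁴|Z|)"* — for a family of admissible Z′₀ indexed by `J`, determined by their complements
`w j ⊆ s` (`w` injective, `s` = the n LM-cubes of Z): Σ_j e^{−b|w j|} ≤ Σ_{W ⊆ s} e^{−b|W|} ≤ exp(n·e^{−b})
(`B13.sum_powerset_le_exp_234`). [cite: Balaban1988RG2Cluster, p.20 (before Lemma 3)] -/
theorem sum_exp_card_le {J α : Type*} [Fintype J] [DecidableEq α] (s : Finset α) (w : J → Finset α)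
    (hw : Function.Injective w) (hws : ∀ j, w j ⊆ s) (b : ℝ) :
    ∑ j, Real.exp (-(b * (w j).card)) ≤ Real.exp ((s.card : ℝ) * Real.exp (-b)) := by
  classical
  have hterm : ∀ j, Real.exp (-(b * (w j).card)) = Real.exp (-b) ^ (w j).card := by
    intro j
    rw [← Real.exp_nat_mul]
    ring_nf
  calc ∑ j, Real.exp (-(b * (w j).card)) = ∑ j, Real.exp (-b) ^ (w j).card := sum_congr rfl fun j _ => hterm j
    _ = ∑ W ∈ univ.image w, Real.exp (-b) ^ W.card := by
        rw [sum_image fun j _ j' _ h => hw h]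
    _ ≤ ∑ W ∈ s.powerset, Real.exp (-b) ^ W.card := by
        refine sum_le_sum_of_subset_of_nonneg ?_ fun W _ _ => by positivity
        intro W hW
        obtain ⟨j, -, rfl⟩ := mem_image.1 hW
        exact mem_powerset.2 (hws j)
    _ ≤ Real.exp ((s.card : ℝ) * Real.exp (-b)) := B13.sum_powerset_le_exp_234 s _ (Real.exp_nonneg _)

/-! ## §2. One Z′₀: the bracket of (2.37) and half of the first exponential -/

/-- P. 20: *"Using the inequality (2.32), properly adapted to the new situation, we bound the exponential factors in the
square bracket above, and half of the first exponential factor, by exp(−(1 − 7δ)½Lκd_{k+1}(Z)). Of course, we assume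
that ½(κ₁ − 1) ≧ 2Lκ. … We leave one factor 2(L+2)⁴O(1)ε₂, and the remaining factors are estimated by 1."* — for one
Z′₀ with m ≥ 1 components of lengths `dI i` and `out` = (LM)⁻⁴|Z∖Z′₀| cubes outside: from the adapted (2.32)
`dZ ≤ Σ_i dI i + c₃₂·out`, R20 in the form `c₃₂·r₇ ≤ ½(κ₁ − 1)` (print: c₃₂ = 4, r₇ ≤ ½Lκ) and 0 ≤ F ≤ 1,
`e^{−(κ₁−1)out}·Π_i F e^{−r₇ dI i} ≤ F·e^{−r₇ dZ}·e^{−½(κ₁−1)out}`. [cite: Balaban1988RG2Cluster, p.20 (before Lemma 3)] -/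
theorem term_le_237 {I : Type*} [Fintype I] [Nonempty I] (dI : I → ℝ) {F r₇ κ₁ c₃₂ dZ out : ℝ}
    (hF0 : 0 ≤ F) (hF1 : F ≤ 1) (hr : 0 ≤ r₇) (hout : 0 ≤ out)
    (h232 : dZ ≤ ∑ i, dI i + c₃₂ * out) (hR20 : c₃₂ * r₇ ≤ (κ₁ - 1) / 2) :
    Real.exp (-((κ₁ - 1) * out)) * ∏ i, (F * Real.exp (-(r₇ * dI i))) ≤
      F * Real.exp (-(r₇ * dZ)) * Real.exp (-((κ₁ - 1) / 2 * out)) := by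
  have hm : 0 < Fintype.card I := Fintype.card_pos
  -- the bracket: F^m · e^{−r₇ Σ dI}
  have hprod : ∏ i, (F * Real.exp (-(r₇ * dI i))) = F ^ Fintype.card I * Real.exp (-(r₇ * ∑ i, dI i)) := by
    rw [prod_mul_distrib, prod_const, card_univ, ← Real.exp_sum]
    congr 1
    rw [mul_sum, ← sum_neg_distrib]
  have hFm : F ^ Fintype.card I ≤ F := pow_le_of_le_one hF0 hF1 hm.ne'
  -- (2.32) adapted: −r₇ Σ dI ≤ −r₇ dZ + r₇ c₃₂ out
  have hexp1 : Real.exp (-(r₇ * ∑ i, dI i)) ≤ Real.exp (-(r₇ * dZ) + r₇ * c₃₂ * out) := by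
    apply Real.exp_le_exp.2
    have := mul_le_mul_of_nonneg_left h232 hr
    nlinarith
  -- R20: −(κ₁−1) out + r₇ c₃₂ out ≤ −½(κ₁−1) out
  have hexp2 : Real.exp (-((κ₁ - 1) * out)) * Real.exp (-(r₇ * dZ) + r₇ * c₃₂ * out) ≤
      Real.exp (-(r₇ * dZ)) * Real.exp (-((κ₁ - 1) / 2 * out)) := by
    rw [← Real.exp_add, ← Real.exp_add]
    apply Real.exp_le_exp.2
    have : r₇ * c₃₂ * out ≤ (κ₁ - 1) / 2 * out := by
      have := mul_le_mul_of_nonneg_right hR20 hout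
      linarith [mul_comm c₃₂ r₇]
    linarith
  calc Real.exp (-((κ₁ - 1) * out)) * ∏ i, (F * Real.exp (-(r₇ * dI i)))
      = Real.exp (-((κ₁ - 1) * out)) * (F ^ Fintype.card I * Real.exp (-(r₇ * ∑ i, dI i))) := by rw [hprod]
    _ ≤ Real.exp (-((κ₁ - 1) * out)) * (F * Real.exp (-(r₇ * dZ) + r₇ * c₃₂ * out)) := by
        gcongr
    _ = F * (Real.exp (-((κ₁ - 1) * out)) * Real.exp (-(r₇ * dZ) + r₇ * c₃₂ * out)) := by ring
    _ ≤ F * (Real.exp (-(r₇ * dZ)) * Real.exp (-((κ₁ - 1) / 2 * out))) :=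
        mul_le_mul_of_nonneg_left hexp2 hF0
    _ = F * Real.exp (-(r₇ * dZ)) * Real.exp (-((κ₁ - 1) / 2 * out)) := by ring

/-! ## §3. The paragraph: (2.37) for every Z′₀ ⊂ Z ⇒ the (2.38)-shape bound for H(Z) = Σ_{Z′₀} … -/

/-- **P. 20, the closing paragraph of the proof of Lemma 3, PROVED as bookkeeping** (verbatim in the module header):
for ONE Z ∈ 𝐃_{k+1} with n LM-cubes (`s.card = n`) and d_{k+1}(Z) = `dZ`, activity H(Z) = Σ_j T j over the admissible
Z′₀ (injection `w` into the subsets of the cubes, `w j` = cubes of Z∖Z′₀; non-empty component families `I j` with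
lengths `dI j i ≥ 0`), GIVEN (2.37) for every Z′₀, the adapted (2.32) with constant c₃₂, R20 as `c₃₂ r₇ ≤ ½(κ₁−1)`,
`0 ≤ F ≤ 1`, the absolute constant `a₅ + e^{−½(κ₁−1)} ≤ A` (`a₅ ≥ 0`), the REPAIRED additive volume law
`n ≤ c₁(1 + dZ)` and `A c₁ ≤ δℓκ`:  ‖H(Z)‖ ≤ F·e^{Ac₁}·exp(−(r₇ − δℓκ)·dZ) — with r₇ = (1 − 7δ)ℓκ this is
F e^{Ac₁} exp(−(1 − 8δ)ℓκ d_{k+1}(Z)).  The printed *"bound the exponentials by 1"* (via the multiplicative (2.30))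
is replaced by the honest e^{Ac₁} (G-B13-P18-01: (2.30) fails at d_{k+1}(Z) = 0), which the O(1) of C₃ absorbs.
[cite: Balaban1988RG2Cluster, (2.38) p.20] -/
theorem norm_sum_le_238 {J α : Type*} [Fintype J] [DecidableEq α] (I : J → Type*) [∀ j, Fintype (I j)]
    [∀ j, Nonempty (I j)] (dI : ∀ j, I j → ℝ) (s : Finset α) (w : J → Finset α) (hw : Function.Injective w)
    (hws : ∀ j, w j ⊆ s) (T : J → ℂ) {F r₇ κ₁ c₃₂ dZ a₅ A c₁ dlk : ℝ}
    (hF0 : 0 ≤ F) (hF1 : F ≤ 1) (hr : 0 ≤ r₇) (hdZ : 0 ≤ dZ)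
    (h232 : ∀ j, dZ ≤ ∑ i, dI j i + c₃₂ * (w j).card) (hR20 : c₃₂ * r₇ ≤ (κ₁ - 1) / 2)
    (h237 : ∀ j, ‖T j‖ ≤ Real.exp (-((κ₁ - 1) * (w j).card)) * (∏ i, (F * Real.exp (-(r₇ * dI j i)))) *
      Real.exp (a₅ * s.card))
    (ha₅ : 0 ≤ a₅) (habs : a₅ + Real.exp (-((κ₁ - 1) / 2)) ≤ A)
    (hvol : (s.card : ℝ) ≤ c₁ * (1 + dZ)) (hAc : A * c₁ ≤ dlk) :
    ‖∑ j, T j‖ ≤ F * Real.exp (A * c₁) * Real.exp (-((r₇ - dlk) * dZ)) := by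
  classical
  set n : ℝ := (s.card : ℝ) with hn
  have hn0 : 0 ≤ n := by rw [hn]; positivity
  set b : ℝ := (κ₁ - 1) / 2 with hb
  -- each term, after §2
  have hT : ∀ j, ‖T j‖ ≤ F * Real.exp (-(r₇ * dZ)) * Real.exp (a₅ * n) * Real.exp (-(b * (w j).card)) := by
    intro j
    have h1 := term_le_237 (dI j) (out := ((w j).card : ℝ)) hF0 hF1 hr (by positivity) (h232 j) hR20
    calc ‖T j‖ ≤ Real.exp (-((κ₁ - 1) * (w j).card)) * (∏ i, (F * Real.exp (-(r₇ * dI j i)))) *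
          Real.exp (a₅ * s.card) := h237 j
      _ ≤ F * Real.exp (-(r₇ * dZ)) * Real.exp (-((κ₁ - 1) / 2 * (w j).card)) * Real.exp (a₅ * s.card) :=
          mul_le_mul_of_nonneg_right h1 (Real.exp_nonneg _)
      _ = F * Real.exp (-(r₇ * dZ)) * Real.exp (a₅ * n) * Real.exp (-(b * (w j).card)) := by
          rw [hb, hn]; ring
  -- sum over Z′₀
  have hsum : ‖∑ j, T j‖ ≤ F * Real.exp (-(r₇ * dZ)) * Real.exp (a₅ * n) * ∑ j, Real.exp (-(b * (w j).card)) := by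
    calc ‖∑ j, T j‖ ≤ ∑ j, ‖T j‖ := norm_sum_le _ _
      _ ≤ ∑ j, F * Real.exp (-(r₇ * dZ)) * Real.exp (a₅ * n) * Real.exp (-(b * (w j).card)) := sum_le_sum fun j _ => hT j
      _ = F * Real.exp (-(r₇ * dZ)) * Real.exp (a₅ * n) * ∑ j, Real.exp (-(b * (w j).card)) := by rw [← mul_sum]
  have h234 : ∑ j, Real.exp (-(b * (w j).card)) ≤ Real.exp (n * Real.exp (-b)) := sum_exp_card_le s w hw hws b
  have hpref : 0 ≤ F * Real.exp (-(r₇ * dZ)) * Real.exp (a₅ * n) := by positivity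
  -- the two exponentials in n: e^{a₅ n} e^{n e^{-b}} ≤ e^{A n} ≤ e^{A c₁ (1 + dZ)}
  have hA0 : 0 ≤ A := le_trans (by positivity) habs
  have hexpn : Real.exp (a₅ * n) * Real.exp (n * Real.exp (-b)) ≤ Real.exp (A * c₁) * Real.exp (A * c₁ * dZ) := by
    rw [← Real.exp_add, ← Real.exp_add]
    apply Real.exp_le_exp.2
    have h1 : a₅ * n + n * Real.exp (-b) = (a₅ + Real.exp (-b)) * n := by ring
    have h2 : (a₅ + Real.exp (-b)) * n ≤ A * n := mul_le_mul_of_nonneg_right habs hn0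
    have h3 : A * n ≤ A * (c₁ * (1 + dZ)) := mul_le_mul_of_nonneg_left hvol hA0
    nlinarith
  -- absorb A c₁ dZ into the rate: −r₇ dZ + A c₁ dZ ≤ −(r₇ − dlk) dZ
  have hrate : Real.exp (-(r₇ * dZ)) * Real.exp (A * c₁ * dZ) ≤ Real.exp (-((r₇ - dlk) * dZ)) := by
    rw [← Real.exp_add]
    apply Real.exp_le_exp.2
    have := mul_le_mul_of_nonneg_right hAc hdZ
    nlinarith
  calc ‖∑ j, T j‖ ≤ F * Real.exp (-(r₇ * dZ)) * Real.exp (a₅ * n) * ∑ j, Real.exp (-(b * (w j).card)) := hsum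
    _ ≤ F * Real.exp (-(r₇ * dZ)) * Real.exp (a₅ * n) * Real.exp (n * Real.exp (-b)) :=
        mul_le_mul_of_nonneg_left h234 hpref
    _ = F * Real.exp (-(r₇ * dZ)) * (Real.exp (a₅ * n) * Real.exp (n * Real.exp (-b))) := by ring
    _ ≤ F * Real.exp (-(r₇ * dZ)) * (Real.exp (A * c₁) * Real.exp (A * c₁ * dZ)) := by gcongr
    _ = F * Real.exp (A * c₁) * (Real.exp (-(r₇ * dZ)) * Real.exp (A * c₁ * dZ)) := by ring
    _ ≤ F * Real.exp (A * c₁) * Real.exp (-((r₇ - dlk) * dZ)) := by gcongr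

/-! ## §4. Lemma 3's (2.38) for step data whose activity is such a sum -/

/-- **(2.37) ⇒ (2.38)** for the step carrier `B13.StepData` (general transfer factor ℓ; print ℓ = ½L): if for every
Z ∈ 𝐃_{k+1} and every configuration in the space of p. 15 the activity `S.H Z` is the sum over the admissible Z′₀ of
terms obeying (2.37) — data and hypotheses of `norm_sum_le_238` with `dZ = d_{k+1}(Z)`, r₇ = (1 − 7δ)ℓκ, R20 as
`c₃₂(1 − 7δ)ℓκ ≤ ½(κ₁ − 1)`, the repaired volume law `n(Z) ≤ c₁(1 + d_{k+1}(Z))`, `A c₁ ≤ δℓκ` — and the O(1) of C₃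
absorbs the volume constant, `F·e^{Ac₁} ≤ C₃ε₁` (F = 2(L+2)⁴O(1)ε₂ = `B13Step237.bracketF`, C₃ε₁ =
`c.C3act * c.ε₁`), then `B13.Bound238With S c ℓ`: *"|H(Z)| ≦ C₃ε₁ exp(−(1 − 8δ)ℓκd_{k+1}(Z))"*.
[cite: Balaban1988RG2Cluster, Lemma 3 p.20] -/
theorem bound238With_of_237 (S : B13.StepData) (c : B13.Consts) (ℓ : ℝ) {α : Type*} [DecidableEq α]
    (J : S.Dk1.Dom → Type*) [∀ Z, Fintype (J Z)] (I : ∀ Z, J Z → Type*) [∀ Z j, Fintype (I Z j)]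
    [∀ Z j, Nonempty (I Z j)] (dI : ∀ Z j, I Z j → ℝ) (s : S.Dk1.Dom → Finset α) (w : ∀ Z, J Z → Finset α)
    (hw : ∀ Z, Function.Injective (w Z)) (hws : ∀ Z j, w Z j ⊆ s Z) (T : ∀ Z, S.Φ → J Z → ℂ)
    (hrep : ∀ Z φ, φ ∈ S.sp2 Z → S.H Z φ = ∑ j, T Z φ j)
    {F c₃₂ a₅ A c₁ : ℝ} (hF0 : 0 ≤ F) (hF1 : F ≤ 1) (hr : 0 ≤ (1 - 7 * c.δ) * ℓ * c.κ)
    (h232 : ∀ Z j, S.Dk1.dj Z ≤ ∑ i, dI Z j i + c₃₂ * (w Z j).card)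
    (hR20 : c₃₂ * ((1 - 7 * c.δ) * ℓ * c.κ) ≤ (c.κ₁ - 1) / 2)
    (h237 : ∀ Z φ j, φ ∈ S.sp2 Z → ‖T Z φ j‖ ≤ Real.exp (-((c.κ₁ - 1) * (w Z j).card)) *
      (∏ i, (F * Real.exp (-((1 - 7 * c.δ) * ℓ * c.κ * dI Z j i)))) * Real.exp (a₅ * (s Z).card))
    (ha₅ : 0 ≤ a₅) (habs : a₅ + Real.exp (-((c.κ₁ - 1) / 2)) ≤ A)
    (hvol : ∀ Z, ((s Z).card : ℝ) ≤ c₁ * (1 + S.Dk1.dj Z)) (hAc : A * c₁ ≤ c.δ * ℓ * c.κ)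
    (hC3 : F * Real.exp (A * c₁) ≤ c.C3act * c.ε₁) :
    B13.Bound238With S c ℓ := by
  intro Z φ hφ
  rw [hrep Z φ hφ]
  have h := norm_sum_le_238 (I Z) (dI Z) (s Z) (w Z) (hw Z) (hws Z) (T Z φ) (dlk := c.δ * ℓ * c.κ)
    hF0 hF1 hr (S.Dk1.dj_nonneg Z) (h232 Z) hR20 (fun j => h237 Z φ j hφ) ha₅ habs (hvol Z) hAc
  have hrate : (1 - 7 * c.δ) * ℓ * c.κ - c.δ * ℓ * c.κ = (1 - 8 * c.δ) * ℓ * c.κ := by ring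
  rw [hrate] at h
  calc ‖∑ j, T Z φ j‖ ≤ F * Real.exp (A * c₁) * Real.exp (-((1 - 8 * c.δ) * ℓ * c.κ * S.Dk1.dj Z)) := h
    _ ≤ c.C3act * c.ε₁ * Real.exp (-((1 - 8 * c.δ) * ℓ * c.κ * S.Dk1.dj Z)) :=
        mul_le_mul_of_nonneg_right hC3 (Real.exp_nonneg _)

/-- The same at the printed transfer factor ℓ = ½L: (2.37) for every Z′₀ ⊂ Z ⇒ **(2.38) AS PRINTED**, `B13.Bound238 S c`
(`B13.bound238With_half`), with R20 in the printed form *"½(κ₁ − 1) ≧ 2Lκ"* when c₃₂ = 4 (`hR20` at ℓ = ½L reads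
`c₃₂(1 − 7δ)½Lκ ≤ ½(κ₁ − 1)`). [cite: Balaban1988RG2Cluster, (2.38) p.20] -/
theorem bound238_of_237 (S : B13.StepData) (c : B13.Consts) {α : Type*} [DecidableEq α]
    (J : S.Dk1.Dom → Type*) [∀ Z, Fintype (J Z)] (I : ∀ Z, J Z → Type*) [∀ Z j, Fintype (I Z j)]
    [∀ Z j, Nonempty (I Z j)] (dI : ∀ Z j, I Z j → ℝ) (s : S.Dk1.Dom → Finset α) (w : ∀ Z, J Z → Finset α)
    (hw : ∀ Z, Function.Injective (w Z)) (hws : ∀ Z j, w Z j ⊆ s Z) (T : ∀ Z, S.Φ → J Z → ℂ)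
    (hrep : ∀ Z φ, φ ∈ S.sp2 Z → S.H Z φ = ∑ j, T Z φ j)
    {F c₃₂ a₅ A c₁ : ℝ} (hF0 : 0 ≤ F) (hF1 : F ≤ 1) (hr : 0 ≤ (1 - 7 * c.δ) * ((c.L : ℝ) / 2) * c.κ)
    (h232 : ∀ Z j, S.Dk1.dj Z ≤ ∑ i, dI Z j i + c₃₂ * (w Z j).card)
    (hR20 : c₃₂ * ((1 - 7 * c.δ) * ((c.L : ℝ) / 2) * c.κ) ≤ (c.κ₁ - 1) / 2)
    (h237 : ∀ Z φ j, φ ∈ S.sp2 Z → ‖T Z φ j‖ ≤ Real.exp (-((c.κ₁ - 1) * (w Z j).card)) *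
      (∏ i, (F * Real.exp (-((1 - 7 * c.δ) * ((c.L : ℝ) / 2) * c.κ * dI Z j i)))) * Real.exp (a₅ * (s Z).card))
    (ha₅ : 0 ≤ a₅) (habs : a₅ + Real.exp (-((c.κ₁ - 1) / 2)) ≤ A)
    (hvol : ∀ Z, ((s Z).card : ℝ) ≤ c₁ * (1 + S.Dk1.dj Z)) (hAc : A * c₁ ≤ c.δ * ((c.L : ℝ) / 2) * c.κ)
    (hC3 : F * Real.exp (A * c₁) ≤ c.C3act * c.ε₁) :
    B13.Bound238 S c :=
  (B13.bound238With_half S c).1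
    (bound238With_of_237 S c ((c.L : ℝ) / 2) J I dI s w hw hws T hrep hF0 hF1 hr h232 hR20 h237 ha₅ habs hvol hAc hC3)

end Literature.MathematicalPhysics.QuantumFieldTheory.Balaban1983to89.B13Bound238Assembly
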